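import Mathlib
import HarnessLib
import Summits.HubbardSuperconductivity.HubbardSuperconductivity.Theorems.WeakCouplingBCSKlCertTPrimeSpeedFloor
import Summits.HubbardSuperconductivity.HubbardSuperconductivity.Theorems.WeakCouplingBCSKlCertTPrimeAnalyticOfEngineRows
import Summits.HubbardSuperconductivity.HubbardSuperconductivity.Theorems.WeakCouplingBCSKlCertTPrimeSoundnessWindow
import Summits.HubbardSuperconductivity.HubbardSuperconductivity.Theorems.WeakCouplingBCSKlCertB1gTPm03D0125ChannelStates

/-!
# Route `WeakCouplingBCS` — certificate vocabulary for `WcbcsKohnLuttingerB1g` (stmt-HubbardSuperconductivity-0158):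
# the ANALYTIC side of a `t′` certificate row on the hole-pocket window, from the `χ₀` sup row ALONE (every `−1/2 < t′ < 0`)

Cell `gate-hubbard-kl`, seat margin-1 (g18); zero kit.  `t′`-generic twin of `Theorems/WeakCouplingBCSKlCertB1gTPm03D0125ChannelStates.lean` (p723329,
`t′ = −3/10`) on top of the generic sharp speed floor `kltp_speedSq_floor_pocket` / `kltp_isFiniteMeasure_pocket` of
`Theorems/WeakCouplingBCSKlCertTPrimeSpeedFloor.lean` (p723526).  For `−1/2 < t′ < 0` and `μ` on the HOLE-POCKET WINDOW
`4t′ < μ < 0`, `(1 − t′μ)(1 + 4t′²) ≤ (1 − 4t′²)(1 − 2t′)` (all of `(4t′, 0)` at `t′ = −0.1, −0.2`; `μ ≤ −0.8235…` at `t′ = −0.3`):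

* §1 the explicit arc (the trig/Lipschitz helpers `kltp_arc_trig`, `kltp_lipschitz_fst` are reused from p723329) `(k₀, arccos g(k₀))`, `g = (−μ/2 − cos k₀)/(1 + 2t′cos k₀) ∈ (0, 1)`, `k₀ ∈ [π/2, 3π/4]`, of `fermiCurve (squareDispersion 1 t′) μ`
  (`kltp_pocket_arc_point`; needs only `−1/2 < t′ ≤ 0`, `4t′ < μ < 0`);
* §2 its length `≥ π/4` (`kltp_pocket_arc_length`), `‖∇ε_{t′}‖ ≤ 6` for `|t′| ≤ 1/2` (`kltp_pocket_speed_le`), and the Fermi-curve measure of the box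
  `k₀ ∈ [π/2, 3π/4]`, `k₁ ∈ (0, π/2)` is `≥ (1/6)(π/4) > 0` (`kltp_pocket_box_measure_pos`);
* §3 **`kltp_pocket_channelStates_nonempty`** (every `D₄` channel has a channel state; witnesses `1`, `cos k₀ − cos k₁`, `sin k₀ sin k₁`,
  `sin k₀ sin k₁ (cos k₀ − cos k₁)`, `sin k₀` of `Literature…KohnLuttingerChannelStates`), **`kltp_pocket_analytic_of_chi0Sup`**
  (`KLTPAnalytic (squareDispersion 1 t′) μ` from a `χ₀` sup bound on `F × F` alone) and **`kltp_window_U_of_chi0Sup`**: an accepted record (`checkB1gD`)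
  whose boxes lie in the window, a `χ₀` sup bound per box and `EnclosuresB1gTP c t′` give `KLB1gDominatesTP t′ mub mua gamma` — i.e. ANY future `t′ ≠ 0`
  record on this window is conditional on its `χ₀` sup row and its enclosures only (the speed-floor and trial-positivity engine rows of
  `kltp_window_U_of_engineRows` are no longer needed there).

No definitions; nothing here asserts a record, a margin, `K₃`, `U₀`, the window or superconductivity; a Kohn–Luttinger `O(U²)` channel statement is not ODLRO;
nothing here proves superconductivity in the Hubbard model.
References: S. Raghu, S. A. Kivelson, D. J. Scalapino, Phys. Rev. B 81 (2010) 224505, §II (5)–(8), §III (17); L. C. Evans, R. F. Gariepy,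
*Measure Theory and Fine Properties of Functions* (1992), §2.4.
-/

noncomputable section

-- the tree's namespace `Summit.<Summit>.<Problem>.Theorems` repeats the summit name by design (D-0017)
set_option linter.dupNamespace false

namespace Summit.HubbardSuperconductivity.HubbardSuperconductivity.Theorems

open MeasureTheory Set Real CwKLChiralWindow Literature.MathematicalPhysics.QuantumLattice
open scoped ENNReal NNReal

/-! ### §1 An explicit arc of the hole pocket of `ε_{t′}` over `k₀ ∈ [π/2, 3π/4]`, every `−1/2 < t′ ≤ 0` -/

/-- The ordinate function of the arc: for `−1/2 < t′ ≤ 0`, `4t′ < μ < 0` and `cos x ∈ [−1, 0]`,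
`g = (−μ/2 − cos x)/(1 + 2t′cos x) ∈ (0, 1)`. [folklore] -/
theorem kltp_pocket_arc_g {tp μ a : ℝ} (htp1 : -1 / 2 < tp) (htp2 : tp ≤ 0) (hμ1 : 4 * tp < μ) (hμ2 : μ < 0)
    (ha1 : -1 ≤ a) (ha2 : a ≤ 0) :
    0 < (-μ / 2 - a) / (1 + 2 * tp * a) ∧ (-μ / 2 - a) / (1 + 2 * tp * a) < 1 := by
  have hta : 0 ≤ tp * a := mul_nonneg_of_nonpos_of_nonpos htp2 ha2
  have hd : 0 < 1 + 2 * tp * a := by linarith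
  refine ⟨div_pos (by linarith) hd, ?_⟩
  rw [div_lt_one hd]
  nlinarith [mul_nonneg (show (0 : ℝ) ≤ 1 + 2 * tp by linarith) (show (0 : ℝ) ≤ a + 1 by linarith)]

/-- **The arc lies on the Fermi curve**: for `−1/2 < t′ ≤ 0`, `4t′ < μ < 0` and `x ∈ [π/2, 3π/4]`, the point `(x, arccos g(x))` is a point of
`fermiCurve (squareDispersion 1 t′) μ` with second coordinate in `(0, π/2)`. [folklore] -/
theorem kltp_pocket_arc_point {tp μ : ℝ} (htp1 : -1 / 2 < tp) (htp2 : tp ≤ 0) (hμ1 : 4 * tp < μ) (hμ2 : μ < 0)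
    {x : ℝ} (hx : x ∈ Icc (π / 2) (3 * π / 4)) :
    (WithLp.toLp 2 ![x, arccos ((-μ / 2 - cos x) / (1 + 2 * tp * cos x))] : Momentum) ∈
        fermiCurve (squareDispersion 1 tp) μ ∧
      arccos ((-μ / 2 - cos x) / (1 + 2 * tp * cos x)) ∈ Ioo 0 (π / 2) := by
  have hπ := Real.pi_pos
  obtain ⟨hc0, hc1, -⟩ := kltp_arc_trig hx
  obtain ⟨hg0, hg1⟩ := kltp_pocket_arc_g htp1 htp2 hμ1 hμ2 hc1 hc0
  set g := (-μ / 2 - cos x) / (1 + 2 * tp * cos x) with hg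
  have hd : 0 < 1 + 2 * tp * cos x := by nlinarith [mul_nonneg_of_nonpos_of_nonpos htp2 hc0]
  have hgd : g * (1 + 2 * tp * cos x) = -μ / 2 - cos x := by
    rw [hg]; exact div_mul_cancel₀ _ hd.ne'
  have hk1 : arccos g ∈ Ioo 0 (π / 2) := ⟨arccos_pos.2 hg1, arccos_lt_pi_div_two.2 hg0⟩
  refine ⟨⟨?_, ?_⟩, hk1⟩
  · intro i
    fin_cases i
    · simp only [Fin.zero_eta, Matrix.cons_val_zero]
      exact ⟨by linarith [hx.1], by linarith [hx.2]⟩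
    · simp only [Fin.mk_one, Matrix.cons_val_one, Matrix.cons_val_fin_one]
      exact ⟨by linarith [hk1.1], by linarith [hk1.2]⟩
  · simp only [squareDispersion, Matrix.cons_val_zero, Matrix.cons_val_one, Matrix.cons_val_fin_one]
    rw [cos_arccos (by linarith) hg1.le]
    linear_combination (-2 : ℝ) * hgd

/-! ### §2 Length `≥ π/4`, speed `≤ 6`, positive Fermi-curve measure of the box -/

/-- **Length of the arc**: for `−1/2 < t′ ≤ 0`, `4t′ < μ < 0` the part of the Fermi curve of `ε_{t′}` in the box `k₀ ∈ [π/2, 3π/4]`, `k₁ ∈ (0, π/2)`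
has `μH[1] ≥ π/4`. [folklore] -/
theorem kltp_pocket_arc_length {tp μ : ℝ} (htp1 : -1 / 2 < tp) (htp2 : tp ≤ 0) (hμ1 : 4 * tp < μ) (hμ2 : μ < 0) :
    ENNReal.ofReal (π / 4) ≤ μH[1] (fermiCurve (squareDispersion 1 tp) μ ∩
      {k : Momentum | k 0 ∈ Icc (π / 2) (3 * π / 4) ∧ k 1 ∈ Ioo 0 (π / 2)}) := by
  set S := fermiCurve (squareDispersion 1 tp) μ ∩ {k : Momentum | k 0 ∈ Icc (π / 2) (3 * π / 4) ∧ k 1 ∈ Ioo 0 (π / 2)}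
    with hS
  have hcover : Icc (π / 2) (3 * π / 4) ⊆ (fun k : Momentum => k 0) '' S := by
    intro x hx
    obtain ⟨hF, hk1⟩ := kltp_pocket_arc_point htp1 htp2 hμ1 hμ2 hx
    refine ⟨_, ⟨hF, ?_, ?_⟩, ?_⟩
    · simpa only [PiLp.toLp_apply, Matrix.cons_val_zero] using hx
    · simpa only [PiLp.toLp_apply, Matrix.cons_val_one, Matrix.cons_val_fin_one] using hk1
    · simp only [Matrix.cons_val_zero]
  have h1 : μH[1] (Icc (π / 2) (3 * π / 4)) = ENNReal.ofReal (π / 4) := by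
    rw [hausdorffMeasure_real, Real.volume_Icc]
    congr 1; ring
  have h2 : μH[1] ((fun k : Momentum => k 0) '' S) ≤ μH[1] S := by
    have h := kltp_lipschitz_fst.hausdorffMeasure_image_le (d := 1) zero_le_one S
    simpa using h
  calc ENNReal.ofReal (π / 4) = μH[1] (Icc (π / 2) (3 * π / 4)) := h1.symm
    _ ≤ μH[1] ((fun k : Momentum => k 0) '' S) := measure_mono hcover
    _ ≤ μH[1] S := h2

/-- `‖∇ε_{t′}(k)‖ ≤ 6` everywhere, for `|t′| ≤ 1/2`. [folklore] -/
theorem kltp_pocket_speed_le {tp : ℝ} (htp1 : -1 / 2 ≤ tp) (htp2 : tp ≤ 1 / 2) (k : Momentum) :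
    ‖gradient (squareDispersion 1 tp) k‖ ≤ 6 := by
  have hsq := klph_speed_sq tp k
  have hb : (2 * sin (k 0) * (1 + 2 * tp * cos (k 1))) ^ 2 + (2 * sin (k 1) * (1 + 2 * tp * cos (k 0))) ^ 2 ≤ 36 := by
    have h0 := sin_sq_le_one (k 0); have h1 := sin_sq_le_one (k 1)
    have c0 := abs_cos_le_one (k 0); have c1 := abs_cos_le_one (k 1)
    rw [abs_le] at c0 c1
    have e0 : (2 * sin (k 0) * (1 + 2 * tp * cos (k 1))) ^ 2 = 4 * sin (k 0) ^ 2 * (1 + 2 * tp * cos (k 1)) ^ 2 := by ring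
    have e1 : (2 * sin (k 1) * (1 + 2 * tp * cos (k 0))) ^ 2 = 4 * sin (k 1) ^ 2 * (1 + 2 * tp * cos (k 0)) ^ 2 := by ring
    have t1 : |tp * cos (k 1)| ≤ 1 / 2 := by
      rw [abs_mul]; nlinarith [abs_nonneg tp, abs_nonneg (cos (k 1)), abs_le.2 ⟨by linarith, htp2⟩, abs_cos_le_one (k 1)]
    have t0 : |tp * cos (k 0)| ≤ 1 / 2 := by
      rw [abs_mul]; nlinarith [abs_nonneg tp, abs_nonneg (cos (k 0)), abs_le.2 ⟨by linarith, htp2⟩, abs_cos_le_one (k 0)]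
    rw [abs_le] at t0 t1
    have f1 : (1 + 2 * tp * cos (k 1)) ^ 2 ≤ 4 := by nlinarith
    have f0 : (1 + 2 * tp * cos (k 0)) ^ 2 ≤ 4 := by nlinarith
    rw [e0, e1]
    nlinarith [sq_nonneg (sin (k 0)), sq_nonneg (sin (k 1)), sq_nonneg (1 + 2 * tp * cos (k 1)),
      sq_nonneg (1 + 2 * tp * cos (k 0)), mul_nonneg (sq_nonneg (sin (k 0))) (sq_nonneg (1 + 2 * tp * cos (k 1)))]
  nlinarith [norm_nonneg (gradient (squareDispersion 1 tp) k)]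

/-- **Positive Fermi-curve measure of the box** on the hole-pocket window: for `−1/2 < t′ < 0`, `4t′ < μ < 0` and
`(1 − t′μ)(1 + 4t′²) ≤ (1 − 4t′²)(1 − 2t′)`, `σ[ε_{t′}, μ]` gives the box `k₀ ∈ [π/2, 3π/4]`, `k₁ ∈ (0, π/2)` measure `≥ (1/6)(π/4) > 0` (density
`‖∇ε‖⁻¹ ≥ 1/6` on the Fermi curve, the speed being positive there by `kltp_speedSq_floor_pocket`). [folklore] -/
theorem kltp_pocket_box_measure_pos {tp μ : ℝ} (htp1 : -1 / 2 < tp) (htp2 : tp < 0) (hμ1 : 4 * tp < μ) (hμ2 : μ < 0)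
    (hH : (1 - tp * μ) * (1 + 4 * tp ^ 2) ≤ (1 - 4 * tp ^ 2) * (1 - 2 * tp)) :
    0 < fermiCurveMeasure (squareDispersion 1 tp) μ
      {k : Momentum | k 0 ∈ Icc (π / 2) (3 * π / 4) ∧ k 1 ∈ Ioo 0 (π / 2)} := by
  have hπ := Real.pi_pos
  set ε := squareDispersion 1 tp with hε
  set B := {k : Momentum | k 0 ∈ Icc (π / 2) (3 * π / 4) ∧ k 1 ∈ Ioo 0 (π / 2)} with hB
  have hc0 : Measurable fun k : Momentum => k 0 := (PiLp.continuous_apply 2 (fun _ : Fin 2 => ℝ) 0).measurable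
  have hc1 : Measurable fun k : Momentum => k 1 := (PiLp.continuous_apply 2 (fun _ : Fin 2 => ℝ) 1).measurable
  have hBm : MeasurableSet B := (hc0 measurableSet_Icc).inter (hc1 measurableSet_Ioo)
  have hFm : MeasurableSet (fermiCurve ε μ) := measurableSet_fermiCurve (measurable_squareDispersion 1 tp) μ
  have hdens : ∀ k ∈ fermiCurve ε μ, ENNReal.ofReal (1 / 6) ≤ ENNReal.ofReal (‖gradient ε k‖⁻¹) := by
    intro k hk
    apply ENNReal.ofReal_le_ofReal
    have hfl := kltp_speedSq_floor_pocket htp1 htp2 hμ2.le hH hk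
    have hpos : 0 < ‖gradient ε k‖ := by
      have hprod : 0 < (μ - 4 * tp) * (4 - 4 * tp - μ) := mul_pos (by linarith) (by linarith)
      have h2 : 0 < ‖gradient ε k‖ ^ 2 := by
        rw [hε, klph_speed_sq]
        linarith
      nlinarith [norm_nonneg (gradient ε k)]
    rw [one_div]
    exact inv_anti₀ hpos (kltp_pocket_speed_le htp1.le (by linarith) k)
  unfold fermiCurveMeasure
  rw [withDensity_apply _ hBm, Measure.restrict_restrict hBm]
  have hlow : ENNReal.ofReal (1 / 6) * μH[1] (B ∩ fermiCurve ε μ) ≤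
      ∫⁻ k in B ∩ fermiCurve ε μ, ENNReal.ofReal (‖gradient ε k‖⁻¹) ∂(μH[1] : Measure Momentum) := by
    calc ENNReal.ofReal (1 / 6) * μH[1] (B ∩ fermiCurve ε μ)
        = ∫⁻ _ in B ∩ fermiCurve ε μ, ENNReal.ofReal (1 / 6) ∂(μH[1] : Measure Momentum) := by
          rw [lintegral_const, Measure.restrict_apply MeasurableSet.univ, univ_inter]
      _ ≤ ∫⁻ k in B ∩ fermiCurve ε μ, ENNReal.ofReal (‖gradient ε k‖⁻¹) ∂(μH[1] : Measure Momentum) := by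
          refine lintegral_mono_ae ?_
          filter_upwards [ae_restrict_mem (hBm.inter hFm)] with k hk
          exact hdens k hk.2
  refine lt_of_lt_of_le ?_ hlow
  have hlen : ENNReal.ofReal (π / 4) ≤ μH[1] (B ∩ fermiCurve ε μ) := by
    rw [inter_comm]; exact kltp_pocket_arc_length htp1 htp2.le hμ1 hμ2
  have h6 : (0 : ℝ≥0∞) < ENNReal.ofReal (1 / 6) := ENNReal.ofReal_pos.2 (by norm_num)
  have h4 : (0 : ℝ≥0∞) < ENNReal.ofReal (π / 4) := ENNReal.ofReal_pos.2 (by positivity)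
  exact lt_of_lt_of_le (ENNReal.mul_pos h6.ne' h4.ne') (mul_le_mul' le_rfl hlen)

/-! ### §3 Channel states in every channel, and `KLTPAnalytic` from a `χ₀` sup bound alone -/

/-- A continuous bounded function vanishing nowhere on the box has positive square integral against `σ[ε_{t′}, μ]` on the hole-pocket window. [folklore] -/
theorem kltp_pocket_sq_integral_pos {tp μ : ℝ} (htp1 : -1 / 2 < tp) (htp2 : tp < 0) (hμ1 : 4 * tp < μ) (hμ2 : μ < 0)
    (hH : (1 - tp * μ) * (1 + 4 * tp ^ 2) ≤ (1 - 4 * tp ^ 2) * (1 - 2 * tp)) {φ : Momentum → ℝ} (hφ : Continuous φ)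
    {C : ℝ} (hC : ∀ k, |φ k| ≤ C)
    (hne : ∀ k : Momentum, k 0 ∈ Icc (π / 2) (3 * π / 4) → k 1 ∈ Ioo 0 (π / 2) → φ k ≠ 0) :
    0 < ∫ k, φ k ^ 2 ∂fermiCurveMeasure (squareDispersion 1 tp) μ := by
  set σ := fermiCurveMeasure (squareDispersion 1 tp) μ with hσ
  haveI : IsFiniteMeasure σ := kltp_isFiniteMeasure_pocket htp1 htp2 hμ1 hμ2.le hH
  have hmeas : AEStronglyMeasurable (fun k => φ k ^ 2) σ := (hφ.pow 2).aestronglyMeasurable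
  have hint : Integrable (fun k => φ k ^ 2) σ := by
    refine (MemLp.of_bound hmeas (C ^ 2) (Filter.Eventually.of_forall fun k => ?_)).integrable le_rfl
    rw [Real.norm_eq_abs, abs_pow, ← sq_abs C]
    exact pow_le_pow_left₀ (abs_nonneg _) ((hC k).trans (le_abs_self C)) 2
  rw [integral_pos_iff_support_of_nonneg (fun k => sq_nonneg (φ k)) hint]
  refine lt_of_lt_of_le (kltp_pocket_box_measure_pos htp1 htp2 hμ1 hμ2 hH) (measure_mono fun k hk => ?_)
  rw [Function.mem_support]
  exact pow_ne_zero 2 (hne k hk.1 hk.2)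

/-- **Every symmetry channel has a channel state on the hole-pocket window** of the `t`–`t′` band (`−1/2 < t′ < 0`, `4t′ < μ < 0`,
`(1 − t′μ)(1 + 4t′²) ≤ (1 − 4t′²)(1 − 2t′)`): witnesses `1`, `cos k₀ − cos k₁`, `sin k₀ sin k₁`, `sin k₀ sin k₁ (cos k₀ − cos k₁)`, `sin k₀`.
[cite: RaghuKivelsonScalapino2010, §III (17)] -/
theorem kltp_pocket_channelStates_nonempty {tp μ : ℝ} (htp1 : -1 / 2 < tp) (htp2 : tp < 0) (hμ1 : 4 * tp < μ) (hμ2 : μ < 0)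
    (hH : (1 - tp * μ) * (1 + 4 * tp ^ 2) ≤ (1 - 4 * tp ^ 2) * (1 - 2 * tp)) (χ : D4Irrep) :
    {ψ | IsChannelState (squareDispersion 1 tp) μ χ ψ}.Nonempty := by
  have hπ := Real.pi_pos
  haveI : IsFiniteMeasure (fermiCurveMeasure (squareDispersion 1 tp) μ) := kltp_isFiniteMeasure_pocket htp1 htp2 hμ1 hμ2.le hH
  have box : ∀ k : Momentum, k 0 ∈ Icc (π / 2) (3 * π / 4) → k 1 ∈ Ioo 0 (π / 2) →
      0 < sin (k 0) ∧ 0 < sin (k 1) ∧ cos (k 0) - cos (k 1) < 0 := by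
    intro k h0 h1
    obtain ⟨hc0, -, hs0⟩ := kltp_arc_trig h0
    have hs1 : 0 < sin (k 1) := sin_pos_of_pos_of_lt_pi h1.1 (by linarith [h1.2])
    have hc1 : 0 < cos (k 1) := cos_pos_of_mem_Ioo ⟨by linarith [h1.1], h1.2⟩
    exact ⟨hs0, hs1, by linarith⟩
  cases χ with
  | A1g =>
    exact klph_channelStates_nonempty_of_bound_of_pos (φ := fun _ => (1 : ℝ)) continuous_const.aestronglyMeasurable
      (C := 1) (fun _ => by simp) (inChannel_A1g_const 1)
      (kltp_pocket_sq_integral_pos htp1 htp2 hμ1 hμ2 hH continuous_const (C := 1) (fun _ => by simp) (fun _ _ _ => one_ne_zero))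
  | B1g =>
    have hcont : Continuous fun k : Momentum => cos (k 0) - cos (k 1) := by fun_prop
    have hbd : ∀ k : Momentum, |cos (k 0) - cos (k 1)| ≤ 2 := fun k => by
      have h1 := abs_cos_le_one (k 0); have h2 := abs_cos_le_one (k 1)
      calc |cos (k 0) - cos (k 1)| ≤ |cos (k 0)| + |cos (k 1)| := abs_sub _ _
        _ ≤ 2 := by linarith
    exact klph_channelStates_nonempty_of_bound_of_pos hcont.aestronglyMeasurable hbd inChannel_B1g_harmonic
      (kltp_pocket_sq_integral_pos htp1 htp2 hμ1 hμ2 hH hcont hbd fun k h0 h1 => (box k h0 h1).2.2.ne)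
  | B2g =>
    have hcont : Continuous fun k : Momentum => sin (k 0) * sin (k 1) := by fun_prop
    have hbd : ∀ k : Momentum, |sin (k 0) * sin (k 1)| ≤ 1 := fun k => by
      rw [abs_mul]
      have h1 := abs_sin_le_one (k 0); have h2 := abs_sin_le_one (k 1)
      nlinarith [abs_nonneg (sin (k 0)), abs_nonneg (sin (k 1))]
    exact klph_channelStates_nonempty_of_bound_of_pos hcont.aestronglyMeasurable hbd inChannel_B2g_harmonic
      (kltp_pocket_sq_integral_pos htp1 htp2 hμ1 hμ2 hH hcont hbd fun k h0 h1 =>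
        (mul_pos (box k h0 h1).1 (box k h0 h1).2.1).ne')
  | A2g =>
    have hcont : Continuous fun k : Momentum => sin (k 0) * sin (k 1) * (cos (k 0) - cos (k 1)) := by fun_prop
    have hbd : ∀ k : Momentum, |sin (k 0) * sin (k 1) * (cos (k 0) - cos (k 1))| ≤ 2 := fun k => by
      rw [abs_mul, abs_mul]
      have h1 := abs_sin_le_one (k 0); have h2 := abs_sin_le_one (k 1)
      have h3 : |cos (k 0) - cos (k 1)| ≤ 2 := by
        have h1 := abs_cos_le_one (k 0); have h2 := abs_cos_le_one (k 1)
        calc |cos (k 0) - cos (k 1)| ≤ |cos (k 0)| + |cos (k 1)| := abs_sub _ _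
          _ ≤ 2 := by linarith
      have h12 : |sin (k 0)| * |sin (k 1)| ≤ 1 := by nlinarith [abs_nonneg (sin (k 0)), abs_nonneg (sin (k 1))]
      nlinarith [abs_nonneg (sin (k 0)), abs_nonneg (sin (k 1)), abs_nonneg (cos (k 0) - cos (k 1)),
        mul_nonneg (abs_nonneg (sin (k 0))) (abs_nonneg (sin (k 1)))]
    exact klph_channelStates_nonempty_of_bound_of_pos hcont.aestronglyMeasurable hbd inChannel_A2g_harmonic
      (kltp_pocket_sq_integral_pos htp1 htp2 hμ1 hμ2 hH hcont hbd fun k h0 h1 => by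
        have hb := box k h0 h1
        exact (mul_neg_of_pos_of_neg (mul_pos hb.1 hb.2.1) hb.2.2).ne)
  | E =>
    have hcont : Continuous fun k : Momentum => sin (k 0) := by fun_prop
    exact klph_channelStates_nonempty_of_bound_of_pos hcont.aestronglyMeasurable (fun k => abs_sin_le_one (k 0))
      inChannel_E_harmonic (kltp_pocket_sq_integral_pos htp1 htp2 hμ1 hμ2 hH hcont (fun k => abs_sin_le_one (k 0))
        fun k h0 h1 => (box k h0 h1).1.ne')

/-- **`KLTPAnalytic (squareDispersion 1 t′) μ` on the hole-pocket window from a `χ₀` sup bound ALONE** (`−1/2 < t′ < 0`, `4t′ < μ < 0`,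
`(1 − t′μ)(1 + 4t′²) ≤ (1 − 4t′²)(1 − 2t′)`): finiteness from the generic speed floor, the `D₄` rows (theorems), Hilbert–Schmidt from the bound,
channel states from the arc.  Any future `t′ ≠ 0` record on this window needs only the `χ₀` sup row and its enclosures. [cite: RaghuKivelsonScalapino2010, §II (5)-(8) and §III (17)] -/
theorem kltp_pocket_analytic_of_chi0Sup {tp μ : ℝ} (htp1 : -1 / 2 < tp) (htp2 : tp < 0) (hμ1 : 4 * tp < μ) (hμ2 : μ < 0)
    (hH : (1 - tp * μ) * (1 + 4 * tp ^ 2) ≤ (1 - 4 * tp ^ 2) * (1 - 2 * tp)) {C : ℝ}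
    (hC : ∀ k ∈ fermiCurve (squareDispersion 1 tp) μ, ∀ k' ∈ fermiCurve (squareDispersion 1 tp) μ,
      |lindhardFunction (squareDispersion 1 tp) μ (k + k')| ≤ C) :
    KLTPAnalytic (squareDispersion 1 tp) μ := by
  haveI hfin : IsFiniteMeasure (fermiCurveMeasure (squareDispersion 1 tp) μ) := kltp_isFiniteMeasure_pocket htp1 htp2 hμ1 hμ2.le hH
  exact klTPAnalytic_of tp μ hfin (klph_memLp_kernel_of_bound (measurable_squareDispersion 1 tp) μ hC)
    (kltp_pocket_channelStates_nonempty htp1 htp2 hμ1 hμ2 hH)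

/-- **The `t′` window statement from the `χ₀` sup row and the enclosures alone** (generic in the record): an accepted record (`checkB1gD`) whose boxes
lie in the hole-pocket window of `ε_{t′}`, a `χ₀` sup bound per box, and `EnclosuresB1gTP c tp` give `KLB1gDominatesTP tp mub mua gamma`.
[cite: RaghuKivelsonScalapino2010, §II (7), (13) and §III Fig. 3] -/
theorem kltp_window_U_of_chi0Sup (tp : ℝ) (c : KLCert) (hc : c.checkB1gD = true) (htp1 : -1 / 2 < tp) (htp2 : tp < 0)
    (hwin : ∀ bx ∈ c.boxes, ∀ μ ∈ Set.Icc (bx.mulo : ℝ) (bx.muhi : ℝ),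
      4 * tp < μ ∧ μ < 0 ∧ (1 - tp * μ) * (1 + 4 * tp ^ 2) ≤ (1 - 4 * tp ^ 2) * (1 - 2 * tp))
    {C : ℝ} (hC : ∀ bx ∈ c.boxes, ∀ μ ∈ Set.Icc (bx.mulo : ℝ) (bx.muhi : ℝ),
      ∀ k ∈ fermiCurve (squareDispersion 1 tp) μ, ∀ k' ∈ fermiCurve (squareDispersion 1 tp) μ,
        |lindhardFunction (squareDispersion 1 tp) μ (k + k')| ≤ C)
    (hE : c.EnclosuresB1gTP tp) :
    KLB1gDominatesTP tp ((c.mub : ℚ) : ℝ) ((c.mua : ℚ) : ℝ) ((c.gamma : ℚ) : ℝ) :=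
  kltp_window_U tp c hc (fun bx hbx μ hμ =>
    kltp_pocket_analytic_of_chi0Sup htp1 htp2 (hwin bx hbx μ hμ).1 (hwin bx hbx μ hμ).2.1 (hwin bx hbx μ hμ).2.2 (hC bx hbx μ hμ)) hE

end Summit.HubbardSuperconductivity.HubbardSuperconductivity.Theorems

end
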